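import Mathlib.NumberTheory.BernoulliPolynomials
import Mathlib.NumberTheory.Padics.PadicVal.Basic
import Mathlib.NumberTheory.LegendreSymbol.JacobiSymbol
import Mathlib.Data.ZMod.QuotientGroup
import Summits.BirchSwinnertonDyer.BirchSwinnertonDyer.Theses.BiquadraticEisensteinDescent

/-!
# Sketch (crux-ideate seat 2, g20) — first lemmas for the g20 crux-idea cards on
`HeegnerTwistCouplingInSupply` (stmt-BirchSwinnertonDyer-21381). Scratch only; BSD is not proved by this.

* `JointCouplingFree` / `couplingInSupply_of_jointCouplingFree` — the supply-free transfer target C⁺⁺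
  (as in g19), re-checked: every g20 card reaches the crux through it.
* `prime_dvd_card_iff_orderOf_or_index` — cards `supersingular-residue-bicover` and
  `gross-stark-index-digit`: `h_K = ord[𝔭] · [Cl(K) : ⟨𝔭⟩]`, so `p ∣ h_K ↔ p ∣ ord[𝔭] ∨ p ∣ index`
  (the degree of the closed points of the reduced Heegner cycle times their number).
* `NewtonJetResidue` — card `supersingular-residue-bicover`, first lemma in its genus-0 avatar: the
  logarithmic derivative of a split polynomial at a non-root is the first negative power sum of the
  root differences (the `i = 1` supersingular residue).
* `exists_rankZero_pos_of_weighted_moment` — card `torsion-weighted-twist-moment`, first lemma (PROVED):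
  an `L`-weighted `p`-torsion moment below `p` forces an index with trivial `p`-torsion and `L > 0`.
* `genBernoulliOdd`, `TrivialZeroValuation` — card `gross-stark-index-digit`, first lemma: all digits of
  the Cohen number `H(k,|d|) = -B_{k,χ_d}/k`, `k = 1 + (p-1)m`, at a `p`-split `d` vanish below
  `1 + v_p(m)` (the trivial zero, N12, made quantitative); the card's claim is about the next digit.
-/

namespace Summit.BirchSwinnertonDyer.BirchSwinnertonDyer.Cruxes.HeegnerTwistCouplingInSupply.SketchG20

open Literature.NumberTheory.EllipticCurves

/-- C⁺⁺ (supply-free joint coupling), verbatim from the g19 sketch. -/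
def JointCouplingFree : Prop :=
  ∀ (W : WeierstrassCurve ℚ) [W.IsElliptic] [W.IsGloballyMinimal] (p : ℕ) [Fact p.Prime]
    [NeZero (W.conductorNorm ℤ)],
    W.HasCM → W.analyticRank = 1 → 5 ≤ p → Rank1Residual.CMInert W p → ¬ Rank1Residual.Good W p →
    ∀ B : ℕ, ∃ (K : Type) (_ : Field K) (_ : NumberField K),
      IsImaginaryQuadratic K ∧ B < (NumberField.discr K).natAbs ∧ 4 < (NumberField.discr K).natAbs ∧
      SatisfiesHeegnerHypothesis (W.conductorNorm ℤ) K ∧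
      (W.quadraticTwist (NumberField.discr K : ℚ)).entireLFunction 1 ≠ 0 ∧
      ¬ p ∣ NumberField.classNumber K

/-- C⁺⁺ implies the crux verbatim (the supply hypothesis is dropped). -/
theorem couplingInSupply_of_jointCouplingFree (h : JointCouplingFree) :
    Summit.BirchSwinnertonDyer.BirchSwinnertonDyer.Theses.BiquadraticEisensteinDescent.HeegnerTwistCouplingInSupply := by
  intro W _ _ p _ _ hCM hr hp hin hgood _hsupply
  obtain ⟨K, iF, iN, hiq, -, h4, hH, hL, hcl⟩ := h W p hCM hr hp hin hgood 0
  exact ⟨K, iF, iN, hiq, h4, hH, hL, hcl⟩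

/-- `h_K = ord(g) · [G : ⟨g⟩]` for any element `g` of a finite group (applied to `G = Cl(K)`, `g = [𝔭]`):
a prime divides the class number iff it divides the order of `[𝔭]` (= the degree over `𝔽_p` of the
closed points of the reduced Heegner cycle) or the index of `⟨[𝔭]⟩` (= the number of those closed points). -/
theorem prime_dvd_card_iff_orderOf_or_index {G : Type*} [Group G] [Finite G] (g : G)
    {p : ℕ} (hp : p.Prime) :
    p ∣ Nat.card G ↔ p ∣ orderOf g ∨ p ∣ (Subgroup.zpowers g).index := by
  rw [← (Subgroup.zpowers g).card_mul_index, Nat.card_zpowers]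
  exact hp.dvd_mul

/-- In the Deuring packet `d = t² − 4pⁿ` the class `[𝔭]` satisfies `[𝔭]ⁿ = 1`, so its order divides `n`;
if `p ∤ n` the first alternative above is excluded for free.  Group-theoretic shadow: -/
theorem not_dvd_orderOf_of_pow_eq_one {G : Type*} [Group G] (g : G) {p n : ℕ}
    (hn : g ^ n = 1) (hpn : ¬ p ∣ n) : ¬ p ∣ orderOf g := by
  intro h
  exact hpn (dvd_trans h (orderOf_dvd_of_pow_eq_one hn))

/-- Card `supersingular-residue-bicover`, first lemma (genus-0 avatar of the supersingular residue
formula): for `H = ∏_{r ∈ R} (X − r)` and `s ∉ R`, `H'(s)/H(s) = Σ_{r∈R} (s − r)⁻¹` — the `i = 1` Taylor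
coefficient of `dlog H` at a supersingular argument `s` is the first negative power sum of the singular
moduli differences `j(τ_𝔞) − j_s`. -/
def NewtonJetResidue (F : Type) [Field F] : Prop :=
  ∀ (R : Finset F) (s : F), s ∉ R →
    (Polynomial.derivative (∏ r ∈ R, (Polynomial.X - Polynomial.C r))).eval s /
        (∏ r ∈ R, (Polynomial.X - Polynomial.C r)).eval s
      = ∑ r ∈ R, (s - r)⁻¹

/-- `(∏_{r∈R} (X − r)).eval s = ∏_{r∈R} (s − r)`. -/
theorem eval_prod_X_sub_C' {F : Type} [Field F] (R : Finset F) (s : F) :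
    (∏ r ∈ R, (Polynomial.X - Polynomial.C r)).eval s = ∏ r ∈ R, (s - r) := by
  simp [Polynomial.eval_prod]

/-- The logarithmic-derivative identity behind `NewtonJetResidue`, over any field (adapted from the
folklore `ℂ`-version in `Literature.Analysis.Complex.ObreschkoffTheorem`). -/
theorem eval_derivative_prod_X_sub_C' {F : Type} [Field F] [DecidableEq F] (R : Finset F) {s : F}
    (hs : ∀ r ∈ R, s ≠ r) :
    (Polynomial.derivative (∏ r ∈ R, (Polynomial.X - Polynomial.C r))).eval s =
      (∏ r ∈ R, (s - r)) * ∑ r ∈ R, (s - r)⁻¹ := by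
  induction R using Finset.induction_on with
  | empty => simp
  | insert a R ha ih =>
    have hs' : ∀ r ∈ R, s ≠ r := fun r hr => hs r (Finset.mem_insert_of_mem hr)
    have hsa : s - a ≠ 0 := sub_ne_zero.2 (hs a (Finset.mem_insert_self a R))
    rw [Finset.prod_insert ha, Polynomial.derivative_mul]
    simp only [Polynomial.eval_add, Polynomial.eval_mul, Polynomial.eval_sub, Polynomial.eval_X,
      Polynomial.eval_C, Polynomial.derivative_sub, Polynomial.derivative_X,
      Polynomial.derivative_C, sub_zero, Polynomial.eval_one, ih hs', eval_prod_X_sub_C',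
      Finset.prod_insert ha, Finset.sum_insert ha]
    field_simp

/-- Card `supersingular-residue` first lemma, PROVED: `NewtonJetResidue F` holds for every field. -/
theorem newtonJetResidue_holds (F : Type) [Field F] : NewtonJetResidue F := by
  classical
  intro R s hs
  have hs' : ∀ r ∈ R, s ≠ r := fun r hr h => hs (h ▸ hr)
  have hprod : (∏ r ∈ R, (s - r)) ≠ 0 :=
    Finset.prod_ne_zero_iff.2 fun r hr => sub_ne_zero.2 (hs' r hr)
  rw [eval_derivative_prod_X_sub_C' R hs', eval_prod_X_sub_C', mul_div_cancel_left₀ _ hprod]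

/-- Card `torsion-weighted-twist-moment`, first lemma (proved): if the `L`-weighted moment of
`p^{r} − 1` is below `(p−1)·ΣL`, some index has `r = 0` and `L > 0`.  (Applied with `i = ` Heegner
discriminant, `r i = rk_p Cl(K_i)`, `L i = L(W^{(d_i)},1) ≥ 0`.) -/
theorem exists_rankZero_pos_of_weighted_moment {ι : Type*} (s : Finset ι) (r : ι → ℕ) (L : ι → ℝ)
    (p : ℕ) (hp : 1 < p) (hL : ∀ i ∈ s, 0 ≤ L i)
    (h : ∑ i ∈ s, ((p : ℝ) ^ (r i) - 1) * L i < ((p : ℝ) - 1) * ∑ i ∈ s, L i) :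
    ∃ i ∈ s, r i = 0 ∧ 0 < L i := by
  by_contra hne
  push Not at hne
  have key : ∀ i ∈ s, ((p : ℝ) - 1) * L i ≤ ((p : ℝ) ^ (r i) - 1) * L i := by
    intro i hi
    by_cases hr : r i = 0
    · have h0 : L i = 0 := le_antisymm (hne i hi hr) (hL i hi)
      simp [h0]
    · apply mul_le_mul_of_nonneg_right _ (hL i hi)
      have h1 : 1 ≤ r i := Nat.one_le_iff_ne_zero.mpr hr
      have hp1 : (1 : ℝ) ≤ (p : ℝ) := by exact_mod_cast hp.le
      have := pow_le_pow_right₀ hp1 h1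
      simp only [pow_one] at this
      linarith
  have hsum := Finset.sum_le_sum key
  rw [← Finset.mul_sum] at hsum
  linarith

/-- Generalised Bernoulli number `B_{k,χ_d}` for an odd fundamental discriminant `d ≡ 1 (mod 4)`, `d < 0`,
via `χ_d(a) = (a / |d|)` (Jacobi) and `B_{k,χ} = f^{k−1} Σ_{a=1}^{f} χ(a) B_k(a/f)`, `f = |d|`. -/
noncomputable def genBernoulliOdd (d : ℤ) (k : ℕ) : ℚ :=
  ((d.natAbs : ℚ) ^ (k - 1)) *
    ∑ a ∈ Finset.range d.natAbs,
      (jacobiSym (a + 1 : ℕ) d.natAbs : ℚ) * (Polynomial.bernoulli k).eval (((a + 1 : ℕ) : ℚ) / d.natAbs)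

/-- Card `gross-stark-index-digit`, first lemma (the trivial zero of N12 made quantitative; the card's
content is the equality case): for `p ≥ 5`, `d < −4` an odd fundamental discriminant with `p` split in
`ℚ(√d)`, and `k = 1 + (p−1)m`, the Cohen number `H(k,|d|) = −B_{k,χ_d}/k` satisfies
`v_p(H(k,|d|)) ≥ 1 + v_p(m)`; the card asserts `= 1 + v_p(m) + v_p([Cl(K):⟨𝔭⟩]) + w_𝔭(d)` with
`w_𝔭(d) = v_p(log_p ū_𝔭) − 1` the Wieferich excess (Ferrero–Greenberg / Gross–Koblitz). -/
def TrivialZeroValuation : Prop :=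
  ∀ (p : ℕ), p.Prime → 5 ≤ p → ∀ (d : ℤ), d < -4 → d % 4 = 1 → Squarefree d →
    IsSquare ((d : ZMod p)) → ∀ (m : ℕ), 0 < m →
      (1 : ℤ) + padicValNat p m ≤
        padicValRat p (genBernoulliOdd d (1 + (p - 1) * m) / (1 + (p - 1) * m : ℚ))

end Summit.BirchSwinnertonDyer.BirchSwinnertonDyer.Cruxes.HeegnerTwistCouplingInSupply.SketchG20
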